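import Mathlib.Tactic.Linarith
import Mathlib.Tactic.NormNum
import Mathlib.Tactic.Ring
import HarnessLib

/-!
# The (0,1) cell of the ι-window, XXXV (companion B): the product ground `B₁ × B₂`, XXII — THE CORNER VI: LEMMA GLUE and THEOREM FAR-II
# (report [XXXV] `H2-ZERO-ONE-35.md` §4): arithmetic shadows

Family `hodge`, b2b cell `hweil` (helper of item stmt-HodgeConjecture-2524). Report
`run/shared/lean/b2b/hodge-weil/b2b-hweil-pv1-g47/H2-ZERO-ONE-35.md` ([XXXV]) §4. Context: LEMMA GLUE compares two Hartshorne–Serre partners on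
`H = B₁ × C₂` that agree, with their local classes, over `(B₁ ∖ A) × C₂` (`A` finite, off `Θ`): they have isomorphic restrictions to `Y₁ = 2S` as soon
as `H¹(C₂, ξ) = 0` (`deg ξ = 2d₃ − 4`) and `H¹(Y₁, 𝓛⁻¹|_{Y₁}) = 0`, the latter being filtered by line bundles on `S = C₁ × C₂` whose `C₁`-degrees are
`2(2n₃ − n′) − 2` and `2(2n₃ − n′)`; THEOREM FAR-II then moves the connected components of the degeneracy curve `W′` that are disjoint from `S`
(translations of free `ι`-orbits: `2` moduli; `ι`-stable ribbon structures on a fixed vertical fibre: `2e − 1 ≥ 3` moduli; invariant functions on a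
fixed fat fibre: `≥ 1 + (d₃ − 4)` from the socle `ξ`, `h⁰(ξ) = 2d₃ − 5`, eigenspaces differing by at most `3`). The theorems below record exactly
these integer facts. None of them claims geometry. HONEST FRAMING: census work inside the ladder's H2 test ((0,1) cell) on the SPECIAL fourfold
`X₀`; nothing here is a rung; no case of the Hodge conjecture is proved; no statement of [Markman 2025] / [Perry 2026] / [EdGFS 2025] is used.
-/

-- mandated namespace `Summit.HodgeConjecture.HodgeConjecture.…` (Problem = Summit) trips `linter.dupNamespace`; the lakefile disables it
-- tree-wide (weak option), restated here so stand-alone elaboration is warning-free too.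
set_option linter.dupNamespace false

namespace Summit.HodgeConjecture.HodgeConjecture.WeilTypeLadder

section ProductGroundTwentyTwoB

/-- **[XXXV] 4.1 (LEMMA GLUE, the vanishing on `Y₁`).** `𝓛⁻¹|_{Y₁}` is filtered by `(M ⊗ K₁⁻¹) ⊠ ξ` and `M ⊠ ξ` on `S`, `deg M = 2(2n₃ − n′)`,
`deg K₁ = 2`; by Künneth (with `H¹(ξ) = 0`) `H¹` vanishes once both `C₁`-degrees are `≥ 3 = 2g − 1`, i.e. `2(2n₃ − n′) − 2 ≥ 3`; since `n′` is even
this is `2n₃ ≥ n′ + 4` (type 1: `n₃ ≥ 7`, degrees `4n₃ − 22 ≥ 6` and `4n₃ − 20 ≥ 8`); at `2n₃ = n′ + 2` the lower layer has degree `2` (vanishing iff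
it is not `K₁`, the `α′ ≠ 0` case). [`omega`] -/
theorem pg22b_glue_degrees :
    (∀ n' n₃ : ℤ, 2 * (2 * n₃ - n') - 2 ≥ 3 ↔ 2 * n₃ - n' ≥ 3) ∧
    (∀ k n₃ : ℤ, 2 * (2 * n₃ - 2 * k) - 2 ≥ 3 ↔ 2 * n₃ ≥ 2 * k + 4) ∧
    (∀ n₃ : ℤ, 7 ≤ n₃ → 6 ≤ 4 * n₃ - 22 ∧ 8 ≤ 4 * n₃ - 20) ∧
    (∀ n' n₃ : ℤ, 2 * n₃ = n' + 2 → 2 * (2 * n₃ - n') - 2 = 2 ∧ 2 * (2 * n₃ - n') = 4) := by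
  refine ⟨fun n' n₃ => ⟨fun h => by omega, fun h => by omega⟩, fun k n₃ => ⟨fun h => by omega, fun h => by omega⟩,
    fun n₃ h => ⟨by omega, by omega⟩, fun n' n₃ h => ⟨by omega, by omega⟩⟩

/-- **[XXXV] 4.3 (THEOREM FAR-II (ii)–(iii), the far vertical fibre).** The conormal quotient of a vertical ribbon with the canonical-degree
condition is `ξ = λ₃λ₄⁻¹`, `deg ξ = 2d₃ − 4`, `h⁰(ξ) = 2d₃ − 5` for `d₃ ≥ 4` and `= 1` for `d₃ = 3` (`ξ ≠ K₂`): a ribbon needs two sections of `ξ`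
without common zero, impossible at `d₃ = 3` (`1 < 2`). The `ι`-stable ribbon structures built from an eigenspace of dimension `e ≥ 2` form a family
of dimension `2e − 1 ≥ 3`. Holomorphic Lefschetz on `C₂` (six fixed points, `±½` each) bounds the difference of the two eigenspace dimensions by
`3`, so for `d₃ ≥ 4` the smaller one has dimension `≥ ((2d₃ − 5) − 3)/2 = d₃ − 4`, and the invariant functions on a fixed far fat fibre
(constants plus socle) number `≥ 1 + (d₃ − 4) ≥ 2` exactly when `d₃ ≥ 5`. There are `16 − 6 = 10` two-torsion points of `B₁` off `Θ`. [`omega`] -/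
theorem pg22b_far_fibre :
    (∀ d₃ : ℤ, 4 ≤ d₃ → (2 * d₃ - 4) + 1 - 2 = 2 * d₃ - 5) ∧ ((2 : ℤ) - 2 + 1 = 1 ∧ (1 : ℤ) < 2) ∧
    (∀ e : ℤ, 2 ≤ e → 3 ≤ 2 * e - 1) ∧
    (∀ d₃ p m : ℤ, 4 ≤ d₃ → p + m = 2 * d₃ - 5 → p - m ≤ 3 → m - p ≤ 3 → d₃ - 4 ≤ p ∧ d₃ - 4 ≤ m) ∧
    (∀ d₃ : ℤ, (2 ≤ 1 + (d₃ - 4) ↔ 5 ≤ d₃)) ∧ ((16 : ℤ) - 6 = 10) := by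
  refine ⟨fun d₃ h => by omega, by norm_num, fun e h => by omega, fun d₃ p m h1 h2 h3 h4 => ⟨by omega, by omega⟩,
    fun d₃ => ⟨fun h => by omega, fun h => by omega⟩, by norm_num⟩

/-- **[XXXV] 4.3 (i), 4.5 (the budget a (0,1) object leaves to the near part).** Type 1: `W′·f′ = 70 − 2n₃(10 − n₃)` (`70, 52, 38, 28` for
`n₃ = 10, 9, 8, 7`) must be carried by components dominating `C₂`; after FAR-II a (0,1) object allows NO far component when `d₃ ≥ 5` and at most
ONE (an `ι`-fixed vertical fibre of multiplicity `m₀ ≥ 3`) when `d₃ ∈ {3, 4}`, so the NEAR components dominating `C₂` (attached vertical fibres and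
bi-dominant curves, all meeting `S` or a curve meeting `S`) carry `≥ W′·f′ − v′ − m₀`; a free far pair would instead give `e₁ ≥ 2`. [`norm_num` / `omega`] -/
theorem pg22b_far_budget :
    ((70 : ℤ) - 2 * 10 * (10 - 10) = 70 ∧ (70 : ℤ) - 2 * 9 * (10 - 9) = 52 ∧ (70 : ℤ) - 2 * 8 * (10 - 8) = 38 ∧ (70 : ℤ) - 2 * 7 * (10 - 7) = 28) ∧
    (∀ f : ℤ, 1 ≤ f → 2 ≤ 2 * f) ∧
    (∀ wf v m₀ near : ℤ, wf = v + m₀ + near → near = wf - v - m₀) := by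
  refine ⟨by norm_num, fun f h => by omega, fun wf v m₀ near h => by omega⟩

end ProductGroundTwentyTwoB

end Summit.HodgeConjecture.HodgeConjecture.WeilTypeLadder
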